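import Literature.AlgebraicGeometry.Resolution.ResolutionOfSingularities
import Literature.AlgebraicGeometry.Resolution.StalkSpecializesLocalization
import Literature.AlgebraicGeometry.Resolution.RegularLocalRingsProofs
import Literature.AlgebraicGeometry.Resolution.PointBlowupHsFunMono
import Mathlib
import HarnessLib

/-!
# [OURS · L1 W4.5(b)] Regularity along the special fibre spreads to the whole scheme over a local base
# — glue for the Δ-centre device of the crux `EquisingularLiftNat` (EL♮, stmt-ResolutionOfSingularities-20038)

NOT a statement of any manuscript. Helper file of the chain res-L1-w45b (CRUX-PLAN v3 §4, CHAIN v6.2 §3;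
lead-2's «device currency» 05:23:05Z: a device lemma ends in one `HorizChainE1` step, which asks for
`IsRegular C.subscheme` of the WHOLE centre). The ring-level Δ-centre toolkit D1 (iii)
(`deltaRegularGeneric`, p502482) gives regularity of a Δ-centre only at the primes containing the
uniformizer `ϖ`, i.e. along its special fibre. This file supplies the missing glue, with no Bertini /
generic-smoothness input on the generic fibre:

* `isRegularLocalRing_stalk_of_specializes` — **regularity generises**: if `x' ⤳ x` and `𝒪_{X,x}` is a
  regular local ring then so is `𝒪_{X,x'}` (the stalk at a generisation is a localisation of the stalk,
  tree `isLocalizationAtPrime_stalkSpecializes` (Stacks 01J7); Serre's theorem, tree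
  `isRegularLocalRing_localization_atPrime` (Matsumura 19.3));
* `exists_specializes_over_closedPoint` — over a LOCAL base ring `O`, every point of a scheme `C` with
  `C → Spec O` universally closed specialises to a point lying over the closed point (closed maps are
  specialising, Mathlib `IsClosedMap.specializingMap`; every point of `Spec O` specialises to the
  closed point);
* `Scheme.isRegular_of_forall_over_closedPoint` — hence **`C` is regular as soon as its local rings at
  the points over the closed point are regular**.
-/

set_option linter.dupNamespace false -- mandated namespace `Summit.<Summit>.<Problem>` of this single-conjunct summit

namespace Summit.ResolutionOfSingularities.ResolutionOfSingularities.Cruxes.EquisingularLiftNat.Sections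

open CategoryTheory AlgebraicGeometry IsLocalRing Literature.AlgebraicGeometry.Resolution

universe u

/-- **Regularity generises.** If `x' ⤳ x` in a scheme `X` and `𝒪_{X,x}` is a regular local ring,
then `𝒪_{X,x'}` is a regular local ring: `𝒪_{X,x'}` is a localisation of `𝒪_{X,x}` at a prime
(Stacks 01J7) and localisations of regular local rings are regular (Serre, Matsumura 19.3).
[folklore] [OURS · L1 W4.5b] -/
theorem isRegularLocalRing_stalk_of_specializes {X : Scheme.{u}} {x x' : X} (h : x' ⤳ x)
    (hx : IsRegularLocalRing (X.presheaf.stalk x)) : IsRegularLocalRing (X.presheaf.stalk x') := by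
  letI := (X.presheaf.stalkSpecializes h).hom.toAlgebra
  set P := (maximalIdeal (X.presheaf.stalk x')).comap (X.presheaf.stalkSpecializes h).hom with hP
  haveI : IsLocalization.AtPrime (X.presheaf.stalk x') P := isLocalizationAtPrime_stalkSpecializes h
  haveI : IsRegularLocalRing (Localization.AtPrime P) :=
    isRegularLocalRing_localization_atPrime (X.presheaf.stalk x) P
  exact IsRegularLocalRing.of_ringEquiv
    (IsLocalization.algEquiv P.primeCompl (Localization.AtPrime P) (X.presheaf.stalk x')).toRingEquiv

/-- Over a local base, **every point specialises into the special fibre** of a universally closed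
morphism: for `f : C ⟶ Spec O` universally closed with `O` local and any `c ∈ C` there is `c₀` with
`c ⤳ c₀` and `f c₀` the closed point (`f` is a closed, hence specialising, map and `f c ⤳ 𝔪_O`).
[folklore] [OURS · L1 W4.5b] -/
theorem exists_specializes_over_closedPoint {O : Type u} [CommRing O] [IsLocalRing O]
    {C : Scheme.{u}} (f : C ⟶ Spec (.of O)) [UniversallyClosed f] (c : C) :
    ∃ c₀ : C, c ⤳ c₀ ∧ f c₀ = IsLocalRing.closedPoint O := by
  have hspec : SpecializingMap f := f.isClosedMap.specializingMap
  have h : f c ⤳ IsLocalRing.closedPoint O := IsLocalRing.specializes_closedPoint (f c)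
  obtain ⟨c₀, hc₀, hfc₀⟩ := hspec h
  exact ⟨c₀, hc₀, hfc₀⟩

/-- **Regular along the special fibre ⇒ regular.** Let `O` be a local ring and `f : C ⟶ Spec O` a
universally closed morphism (e.g. `C` proper over `O`). If the local ring `𝒪_{C,c}` is regular for every
point `c` lying over the closed point of `Spec O`, then `C` is a regular scheme: any point `c`
specialises to such a `c₀` (`exists_specializes_over_closedPoint`) and `𝒪_{C,c}` is a localisation of
the regular local ring `𝒪_{C,c₀}` (`isRegularLocalRing_stalk_of_specializes`). This is the glue that
turns the Δ-centre toolkit's `deltaRegularGeneric` (regularity at the primes containing `ϖ`) into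
`IsRegular` of a Δ-centre inside a proper `O`-scheme. [folklore] [OURS · L1 W4.5b] -/
theorem Scheme.isRegular_of_forall_over_closedPoint {O : Type u} [CommRing O] [IsLocalRing O]
    {C : Scheme.{u}} (f : C ⟶ Spec (.of O)) [UniversallyClosed f]
    (h : ∀ c : C, f c = IsLocalRing.closedPoint O → IsRegularLocalRing (C.presheaf.stalk c)) :
    Scheme.IsRegular C := by
  intro c
  obtain ⟨c₀, hc₀, hfc₀⟩ := exists_specializes_over_closedPoint f c
  exact isRegularLocalRing_stalk_of_specializes hc₀ (h c₀ hfc₀)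

/-- The same with the special fibre written as a preimage: if every point of `f ⁻¹ {𝔪_O}` has a regular
local ring then `C` is regular. [folklore] [OURS · L1 W4.5b] -/
theorem Scheme.isRegular_of_forall_mem_preimage_closedPoint {O : Type u} [CommRing O] [IsLocalRing O]
    {C : Scheme.{u}} (f : C ⟶ Spec (.of O)) [UniversallyClosed f]
    (h : ∀ c ∈ (f : C → Spec (.of O)) ⁻¹' {IsLocalRing.closedPoint O},
      IsRegularLocalRing (C.presheaf.stalk c)) :
    Scheme.IsRegular C :=
  Scheme.isRegular_of_forall_over_closedPoint f fun c hc => h c (show f c ∈ ({IsLocalRing.closedPoint O} : Set _) from hc)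


/-- **Regular along the special fibre ⇒ regular, for a closed subscheme** (the form a `HorizChainE1`
step consumes). Let `q : X ⟶ Spec O` with `O` local and `C` an ideal sheaf on `X` whose closed subscheme
`V(C)` is universally closed over `Spec O` (e.g. `X` proper over `O`). If the quotient stalk
`𝒪_{X,x} / C_x` is a regular local ring for every point `x ∈ V(C)` lying over the closed point, then
`V(C)` is a regular scheme (`Scheme.isRegular_of_forall_over_closedPoint` for `V(C) → Spec O`, and the
local rings of `V(C)` are the quotient stalks, tree `isRegularLocalRing_stalk_subscheme_iff`). With the
Δ-centre toolkit: the quotient stalks at special-fibre points are localisations of `O[x, y]/(g + uϖ)` at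
primes containing `ϖ`, regular by `deltaRegularGeneric`. [folklore] [OURS · L1 W4.5b] -/
theorem Scheme.isRegular_subscheme_of_forall_over_closedPoint {O : Type u} [CommRing O] [IsLocalRing O]
    {X : Scheme.{u}} (q : X ⟶ Spec (.of O)) (C : X.IdealSheafData)
    [UniversallyClosed (C.subschemeι ≫ q)]
    (h : ∀ x ∈ C.support, q x = IsLocalRing.closedPoint O →
      IsRegularLocalRing (X.presheaf.stalk x ⧸ stalkIdeal C x)) :
    Scheme.IsRegular C.subscheme := by
  refine Scheme.isRegular_of_forall_over_closedPoint (C.subschemeι ≫ q) fun s hs => ?_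
  rw [isRegularLocalRing_stalk_subscheme_iff]
  refine h _ ?_ ?_
  · have hmem : C.subschemeι.base s ∈ (C.support : Set X) := by
      rw [← Scheme.IdealSheafData.range_subschemeι]
      exact Set.mem_range_self s
    exact hmem
  · simpa [Scheme.Hom.comp_base] using hs

end Summit.ResolutionOfSingularities.ResolutionOfSingularities.Cruxes.EquisingularLiftNat.Sections
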